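/-
Copyright (c) 2026 the pub-hodgecm-mathlib formalisation cell (harness21).  Prover seat hodgecm-mathlib-F0P2-p02 (g26); E1 keeper ∕ dealer F0P3a-p03 (g30), E1 BRICK
LEDGER row 46″ «K4′ SELF-EXTENSION SPLIT — THE SENTENCE» (twin of row 40″ `F0P3cStCharTSK2PiTwoSelfExtSplitSentence`, F0P3b-p01 (g25); sigsheet 2026-09-03T03:13Z).
-/
import Summits.HodgeConjecture.HodgeConjecture.Theorems.F0P3cStCharTSK4PrimeSelfExtSplit          -- ★ row 46 D′46 (this seat) p853349: `exists_section_selfExtension_of_jacquet_alternative_of_jet_intertwiner` (brings ★ G3, ★ D: (D1), ★ G2, ★ FN, ★ J1∕J2)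
import Summits.HodgeConjecture.HodgeConjecture.Theorems.F0P3cStCharTSK2PiTwoSelfExtSplitSentence -- ★ row 40″ (F0P3b-p01 (g25)): `exists_representation_unipotentModel_jet` (the unipotent model in the JET letters)
import Literature.RepresentationTheory.CharacterSelfExtensionJacquetAlternativeSub               -- ★ row 46′ (this seat) p853350: `jacquetAlternative_of_selfExtension_char_sub` (brings ★ 40′: `finiteDimensional_selfExtension`)
import HarnessLib

/-!
# K4′ — THE SENTENCE: a smooth self-extension of `π⁺ ⊂ i_P(χ₁)` SPLITS, given the self-extension structure of its Jacquet module over the `χ`-line (with `r_P(ι)(r_P π⁺)` the sub line),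
# a height for every occurring non-zero additive character, and a jet intertwiner `(𝒜₀, 𝒜₁)` for each such height jet

Cell `pub/hodgecm-mathlib`, crux H413 = `stmt-HodgeConjecture-24833` (`--supports` lane, helper, THEOREMS ONLY: no definition ∕ instance ∕ notation ∕ named fact ∕ `sorry`).
Namespace `Summit.HodgeConjecture.HodgeConjecture.Cruxes.H413.F0P3cStCharTSK4PrimeSelfExtSplitSentence`.  E1 BRICK LEDGER (F0P3a-p03 (g30)) row 46″ — the K4′ twin of ★ row 40″
(`F0P3cStCharTSK2PiTwoSelfExtSplitSentence.selfExtension_splits_of_jacquet_selfExtension`, F0P3b-p01 (g25)), same architecture and letters: where 40″ carries (ND∀≠0) («`A` does not deform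
along the height jet of any occurring non-zero additive character», the K2′-π² input), 46″ carries **(J∀occ) «a jet intertwiner `(𝒜₀, 𝒜₁)` exists for the height jet of every non-zero
additive character OCCURRING in `r_P τ`»** with `𝒜₀` the FIXED involution (`A = π⁺ ≤ ker(𝒜₀ − 1)`) — the K4′ cell's ONE analytic sentence [Keys1984 §3–§4], PRINT, never discharged.
Seat F0P2-p02 (g26).

THE MATHEMATICS (letters of ★ 40″ VERBATIM).  `t` a parabolic triple of a topological group `G` with `δ_P|_N = 1` (`hδ`), `χ : ↥t.M →* ℂ` unit-valued with its line `χ₁` (`hχ₁`),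
`I₀ := normalizedInd t χ₁` on `V := SmoothInd t.P (χ₁ ∘ proj ⊗ δ^{1/2})`, `τ` SMOOTH on `X`, `0 → A —ι→ τ —p→ A → 0` a self-extension of an invariant irreducible `A ≤ I₀` with
`Hom_G(A, I₀ ∕ A) = 0` and Schur ((a), (d1′) PRINT); (J-data) `𝒜₀ ∈ End_G(I₀)` with `𝒜₀ = 1` on `A` (`hA₀`, `hAfix`); (b) `r_P τ := τ.normalizedJacquet t` IS A SELF-EXTENSION OF THE
`χ`-LINE in ★ CHAR-EXT ∕ 40′ letters (`pJ`, `hquot`, `hker`, `u₀`, `e`, `hu₀`, `he`, `hline`, `hfree`) AND its sub line `ker pJ = ℂ·e` is the image of `r_P A` (`hιker : pJ [ι a] = 0`,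
`hιe : ∃ a, [ι a] = e` — input class: `r_B` exact ★ + «`r_B π⁺` is the `θ̃`-line» PRINT); (H) the HEIGHT ORACLE of ★ 40″ v2 (occurrence antecedent); (J∀occ) as above.
THEN **`p` HAS AN EQUIVARIANT SECTION — `τ` SPLITS** (`selfExtension_splits_of_jacquet_selfExtension_of_jet_intertwiner`).  Proof: the alternative ★ 46′
`jacquetAlternative_of_selfExtension_char_sub` on `r_P τ`; SPLIT branch → ★ D (D1) + ★ G2 `exists_section_of_two_le_finrank` (no jet); NON-SPLIT branch → `λ ≠ 0` occurring, the model
`N₀` (★ 40″ §0), `θ : r_P τ → N₀` missing the sub, carrying `ker pJ` into the sub and with `θ e ≠ 0`, a height `Λ` ((H)), ★ J2's jet package `(π₁, ρ)`, `𝒜₁` ((J∀occ)), and ★ D′46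
`exists_section_selfExtension_of_jacquet_alternative_of_jet_intertwiner` (over ★ G3's Hom-count + ★ D (F)).  At the CM datum (`t := cmBorelTriple L 3 v`, `χ = θ̃`, `A = π⁺`): every smooth
self-extension of `π⁺` splits — the K4′ cell of the residue matrix, Ext-free, modulo the NAMED printed inputs; the datum is ONE partial application (★ D′46's HOME cert shape).
[cite: Keys1984, §3 pp. 118–119; §4 Thm. 3 p. 120] [cite: Rogawski1990, §12.2 p. 173] [cite: Casselman1995, §6.3] [cite: BernsteinZelevinsky1977, §2.3]
HONEST LABEL: count-neutral datum assembly; (d1′)∕(b)∕sub-line∕(H)∕(J∀occ) are PRINT-class named hypotheses; h413 OPEN; HC_CM is proved only modulo the 7 printed citations (2 remaining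
named inputs hLiu418 = stmt-HodgeConjecture-24832, h413 = stmt-HodgeConjecture-24833) until rung 0 closes.

## References
* [Keys1984] D. Keys, *Principal series representations of special unitary groups over local fields*, Compositio Math. 51 (1984), §3 pp. 118–119, §4 Thm. 3 p. 120.
* [Rogawski1990] J. D. Rogawski, *Automorphic Representations of Unitary Groups in Three Variables*, Ann. of Math. Stud. 123 (1990), §12.2 p. 173.
* [Casselman1995] W. Casselman, *Introduction to the theory of admissible representations of p-adic reductive groups* (1995), §6.3.
* [BernsteinZelevinsky1977] I. N. Bernstein, A. V. Zelevinsky, *Induced representations of reductive p-adic groups I*, Ann. Sci. ÉNS 10 (1977), §2.3.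
-/

set_option autoImplicit false

set_option linter.dupNamespace false

noncomputable section

open NumberField IsDedekindDomain

namespace Summit.HodgeConjecture.HodgeConjecture.Cruxes.H413.F0P3cStCharTSK4PrimeSelfExtSplitSentence

open Literature.NumberTheory.Automorphic Literature.NumberTheory.Automorphic.UnitaryGroup Representation Literature.RepresentationTheory
open Summit.HodgeConjecture.HodgeConjecture.Cruxes.H413
open Summit.HodgeConjecture.HodgeConjecture.Cruxes.H413.F0P3cStCharTSK2PiTwoSelfExtSplit
open Summit.HodgeConjecture.HodgeConjecture.Cruxes.H413.F0P3cStCharTSK2PiTwoSelfExtSplitSentence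
open Summit.HodgeConjecture.HodgeConjecture.Cruxes.H413.F0P3cStCharTSK4PrimeSelfExtSplit

/-! ## §1 Any parabolic triple `t` with `δ_P|_N = 1`, `σ₀ := χ₁` a line -/

section AnyTriple

variable {G : Type*} [Group G] [TopologicalSpace G] [IsTopologicalGroup G] (t : ParabolicTriple G) [LocallyCompactSpace ↥t.P]
  (hδ : ∀ (n : G) (hn : n ∈ t.N), deltaChar t.P ⟨n, t.N_le hn⟩ = 1)
  (χ : ↥t.M →* ℂ) (χ₁ : Representation ℂ ↥t.M ℂ) (hχ₁ : ∀ (m : ↥t.M) (x : ℂ), χ₁ m x = χ m * x)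
  {X : Type*} [AddCommGroup X] [Module ℂ X] (τ : Representation ℂ G X) (hτ : τ.IsSmooth)

include hδ hχ₁ hτ in
/-- **K4′ — THE SENTENCE.**  A SMOOTH self-extension `0 → A —ι→ τ —p→ A → 0` of an invariant irreducible `A ≤ I₀ = i_P(χ₁)` with `Hom_G(A, I₀ ∕ A) = 0`, Schur and `𝒜₀ = 1` on `A` for a
`G`-endomorphism `𝒜₀` of `I₀` SPLITS, given: (b) the self-extension structure of its Jacquet module `r_P τ` over the `χ`-line (★ CHAR-EXT letters `pJ u₀ e`) with `ker pJ` the image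
of `r_P A` (`hιker`, `hιe`), (H) a height for every non-zero additive character occurring in `r_P τ`, and (J∀occ) a jet intertwiner `(𝒜₀, 𝒜₁)` for the height jet of every such
character.  At the CM datum (`t := cmBorelTriple L 3 v`, `A = π⁺`, `χ = θ̃`): every smooth self-extension of `π⁺` splits — the K4′ cell of the residue matrix, Ext-free, modulo the NAMED
printed inputs. [cite: Keys1984, §3 pp. 118–119; §4 Thm. 3 p. 120] [cite: Rogawski1990, §12.2 p. 173] [cite: Casselman1995, §6.3] [cite: BernsteinZelevinsky1977, §2.3] -/
theorem selfExtension_splits_of_jacquet_selfExtension_of_jet_intertwiner (hχ : ∀ m, IsUnit (χ m))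
    -- (a) the self-extension of `A ≤ I₀` (★ G2 letters; (d1′) PRINT)
    (A : Submodule ℂ (SmoothInd t.P (Representation.twist (χ₁.comp t.proj) (rootDeltaChar t.P))))
    (hAinv : ∀ g, A ≤ A.comap (Representation.normalizedInd t χ₁ g))
    (hAirr : ∀ B : Submodule ℂ (SmoothInd t.P (Representation.twist (χ₁.comp t.proj) (rootDeltaChar t.P))), B ≤ A →
      (∀ g, B ≤ B.comap (Representation.normalizedInd t χ₁ g)) → B = ⊥ ∨ B = A)
    (hHom0 : ∀ ψ : IntertwiningMap ((Representation.normalizedInd t χ₁).subrepresentation A hAinv) ((Representation.normalizedInd t χ₁).quotient A hAinv), ψ = 0)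
    (hSchur : Module.finrank ℂ (IntertwiningMap ((Representation.normalizedInd t χ₁).subrepresentation A hAinv)
      ((Representation.normalizedInd t χ₁).subrepresentation A hAinv)) = 1)
    -- (J-data) the fixed involution `𝒜₀ ∈ End_G(I₀)` with `𝒜₀ = 1` on `A = π⁺` (PRINT [Keys1984 §4 Thm. 3])
    (A₀ : Module.End ℂ (SmoothInd t.P (Representation.twist (χ₁.comp t.proj) (rootDeltaChar t.P))))
    (hA₀ : ∀ g, A₀ * Representation.normalizedInd t χ₁ g = Representation.normalizedInd t χ₁ g * A₀) (hAfix : ∀ a ∈ A, A₀ a = a)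
    (ι : IntertwiningMap ((Representation.normalizedInd t χ₁).subrepresentation A hAinv) τ)
    (p : IntertwiningMap τ ((Representation.normalizedInd t χ₁).subrepresentation A hAinv))
    (hp : Function.Surjective p) (hexact : LinearMap.ker p.toLinearMap = LinearMap.range ι.toLinearMap)
    -- (b) «`r_P τ` is a self-extension of the `χ`-line» (★ CHAR-EXT ∕ 40′ letters; PRINT input class) …
    (pJ : (t.restrict τ).Coinvariants →ₗ[ℂ] ℂ) (hquot : ∀ (m : ↥t.M) (u : (t.restrict τ).Coinvariants), pJ (τ.normalizedJacquet t m u) = χ m * pJ u)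
    (hker : ∀ (m : ↥t.M) (u : (t.restrict τ).Coinvariants), pJ u = 0 → τ.normalizedJacquet t m u = χ m • u)
    {u₀ e : (t.restrict τ).Coinvariants} (hu₀ : pJ u₀ = 1) (he : pJ e = 0)
    (hline : ∀ w : (t.restrict τ).Coinvariants, pJ w = 0 → ∃ c : ℂ, w = c • e) (hfree : ∀ c : ℂ, c • e = 0 → c = 0)
    -- … WITH `ker pJ = r_P(ι)(r_P A)` (the K4′ sub-line input; input class)
    (hιker : ∀ a : A, pJ (Coinvariants.mk (t.restrict τ) (ι a)) = 0) (hιe : ∃ a : A, Coinvariants.mk (t.restrict τ) (ι a) = e)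
    -- (H) HEIGHT ORACLE for the non-zero additive characters OCCURRING in `r_P τ` (★ 40″ v2's letters VERBATIM)
    (hH : ∀ lam : ↥t.M → ℂ, lam 1 = 0 → (∀ m m' : ↥t.M, lam (m * m') = lam m + lam m') → (∃ m, lam m ≠ 0) →
      (∀ m : ↥t.M, τ.normalizedJacquet t m u₀ - χ m • u₀ = (χ m * lam m) • e) →
      ∃ (Λ : G → ℂ) (KΛ : Subgroup G), IsOpen (KΛ : Set G) ∧ (∀ (x κ : G), κ ∈ KΛ → Λ (x * κ) = Λ x) ∧
        ∀ (q : ↥t.P) (g : G), Λ ((q : G) * g) = lam (t.proj q) + Λ g)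
    -- (J∀occ): a jet intertwiner `(𝒜₀, 𝒜₁)` for the height jet of every non-zero additive character OCCURRING in `r_P τ` (PRINT [Keys1984 §3–§4])
    (hJ : ∀ (lam : ↥t.M → ℂ), (∃ m, lam m ≠ 0) → (∀ m : ↥t.M, τ.normalizedJacquet t m u₀ - χ m • u₀ = (χ m * lam m) • e) →
      ∀ (Λ : G → ℂ), (∀ (q : ↥t.P) (g : G), Λ ((q : G) * g) = lam (t.proj q) + Λ g) →
      ∀ (π₁ : G → Module.End ℂ (SmoothInd t.P (Representation.twist (χ₁.comp t.proj) (rootDeltaChar t.P)))),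
        (∀ (g : G) (w : SmoothInd t.P (Representation.twist (χ₁.comp t.proj) (rootDeltaChar t.P))) (x : G), (π₁ g w).toFun x = (Λ (x * g) - Λ x) • w.toFun (x * g)) →
          ∃ A₁ : Module.End ℂ (SmoothInd t.P (Representation.twist (χ₁.comp t.proj) (rootDeltaChar t.P))),
            ∀ g, A₁ * Representation.normalizedInd t χ₁ g - Representation.normalizedInd t χ₁ g * A₁ = -(π₁ g * A₀ + A₀ * π₁ g)) :
    ∃ s : IntertwiningMap ((Representation.normalizedInd t χ₁).subrepresentation A hAinv) τ,
      p.comp s = IntertwiningMap.id ((Representation.normalizedInd t χ₁).subrepresentation A hAinv) := by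
  -- the Jacquet alternative WITH its sub line (★ 46′) on the self-extension `r_P τ` of the `χ`-line
  rcases jacquetAlternative_of_selfExtension_char_sub (τ.normalizedJacquet t) χ hχ pJ hquot hker hu₀ he hline hfree χ₁ hχ₁ with
    h2 | ⟨lam, hlam1, hlam, hne, hocc, hθ⟩
  · -- SPLIT branch: `2 ≤ dim Hom_M(r_P τ, χ₁) ⇒ 2 ≤ dim Hom_G(τ, I₀)` (★ D (D1)) ⇒ section by Hom-count (★ G2), no jet, no (J)
    exact exists_section_of_two_le_finrank (Representation.normalizedInd t χ₁) A hAinv hAirr hHom0 hSchur τ ι p hp hexact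
      (two_le_finrank_intertwiningMap_normalizedInd_of_jacquet t hδ χ₁ τ hτ h2)
  · -- NON-SPLIT branch: the unipotent model in the JET letters (★ 40″ §0), `θ` with its sub-line clauses, a height, ★ J2's jet package, `𝒜₁`, ★ D′46's assembly
    obtain ⟨N₀, hN₀⟩ := exists_representation_unipotentModel_jet χ lam hlam1 hlam
    obtain ⟨θ, ⟨y, hy⟩, hsub, hθe⟩ := hθ N₀ hN₀
    obtain ⟨Λ, KΛ, hKΛ, hΛK, hΛ⟩ := hH lam hlam1 hlam hne hocc
    have hN₀' : ∀ (m : ↥t.M) (w : ℂ × ℂ), N₀ m w = (χ₁ m w.1, lam m • χ₁ m w.1 + χ₁ m w.2) := fun m w => by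
      rw [hN₀, hχ₁, hχ₁, smul_eq_mul]
    obtain ⟨Ψ, π₁, ρ, -, hπ₁, -, -, hρ, -⟩ :=
      F0P3cStCharTSJetAtDatum.exists_linearEquiv_normalizedInd_unipotentModel_jet t χ₁ lam N₀ hN₀' Λ hΛ KΛ hKΛ hΛK
    obtain ⟨A₁, hA₁⟩ := hJ lam hne hocc Λ hΛ π₁ hπ₁
    -- `r_P τ` is finite-dimensional (★ 40′), so ★ D′46's `[FiniteDimensional]` binders are instances
    haveI : FiniteDimensional ℂ (t.restrict τ).Coinvariants :=
      finiteDimensional_selfExtension (τ.normalizedJacquet t) χ hχ pJ hquot hker hu₀ he hline hfree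
    obtain ⟨a₀, ha₀⟩ := hιe
    exact exists_section_selfExtension_of_jacquet_alternative_of_jet_intertwiner t hδ χ₁ τ lam N₀ hN₀' Λ hΛ KΛ hKΛ hΛK π₁ hπ₁ ρ hρ hτ
      A₀ A₁ hA₀ hA₁ A hAfix hAinv hAirr hHom0 hSchur ι p hp hexact
      (Or.inr ⟨θ, ⟨y, hy⟩, fun a => hsub _ (hιker a), ⟨a₀, by rw [ha₀]; exact hθe⟩⟩)

end AnyTriple

end Summit.HodgeConjecture.HodgeConjecture.Cruxes.H413.F0P3cStCharTSK4PrimeSelfExtSplitSentence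

end
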